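import Summits.BirchSwinnertonDyer.Rank1Residual.X2.RankOneDescentConverse
import Summits.BirchSwinnertonDyer.Rank1Residual.X2.RankZeroExact
import HarnessLib

/-!
# Class X2: the two typed inputs are jointly EXACT — `X2.Target ⟺ (Mazur's MC at every X2b pair)
# ∧ (the Heegner-index identity over K at p ‖ N)` (cell `b2b-bsdres`, unit `b2b-bsdres-eisenstein-p2`,
# gen 3)

HONEST FRAMING (run/shared/lean/b2b/bsd-rank1-residual/, verbatim in every file): the goal of the
cell is to DELETE the COMBINATION-SHAPED residual classes of the Birch–Swinnerton-Dyer formula for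
ALL analytic-rank `≤ 1` elliptic curves over `ℚ` — "full BSD formula for every rank `≤ 1` curve in
class `C`" assembled STRICTLY from published theorems — so that the rank-`≤ 1` remainder becomes
exactly the CONSTRUCTION-SHAPED classes, which are TYPED (missing-input `Prop`s), NOT attempted.
This is not "finishing BSD". Research routes; no claim beyond stated classes. X2b and X2c stay
CONSTRUCTION-SHAPED. Theorems only (no definition, no named fact).

After `X2/RankOneManin.lean` the class statement of record `X2.Target` follows from PUBLISHED named
facts and exactly two typed inputs: `MissingInputB` at every X2b pair (Mazur's main conjecture at a
multiplicative Eisenstein prime of the other parity type — EXACT by `X2/RankZeroExact.lean`) and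
`X2.HeegnerIndexIdentity` (the Heegner-index identity `2·ord_p ∏c_ℓ(E) + ord_p #Ш(E/K) =
2·ord_p [E(K):ℤP_K]` at every CellC pair and every admissible datum). This file proves the
CONVERSE: `X2.Target` implies both typed inputs — so NOTHING weaker than the pair would close the
class, and nothing stronger is being asked for.

* (companion `X2/RankOneDescentConverse.lean`) `indexIdentityAt_of_bsdp` — the exact descent
  `X11b.bsdp_of_indexIdentityAt` (multr1-p2, p199961) run backwards: `BSD(E,p)` + the partner's
  rank-zero print shape ⟹ the identity over `K`.
* `heegnerIndexIdentity_of_target` — `X2.Target` ⟹ `X2.HeegnerIndexIdentity` (the rank-`0`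
  partner `E^{d_K}` is an X2 pair — `classX2_twist` — so `Target` gives its print shape,
  `pPartRankZero_twist_of_rankZero`; the transport values are gen 3's theorems
  `padicValNat_tamagawaProduct_twist_of_heegner_of_odd`, `padicValRat_u_eq_zero_of_smul_quadraticTwist`).
* `target_iff_missingInputB_and_heegnerIndexIdentity` — **`X2.Target ⟺ (∀ X2b pairs,
  MissingInputB) ∧ HeegnerIndexIdentity`**, granted the PUBLISHED facts (⇐:
  `target_of_published_of_missingInputB_of_heegnerIndexIdentity''`; ⇒: `targets_of_target`,
  `cellB_mazurMainConjectureAt_iff_bsdp`, `heegnerIndexIdentity_of_target`).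

References: [JetchevSkinnerWan2017] §7.4.1; [GrossZagier1986] V.§2; [Castella2018] §5;
[KolyvaginEulerSystems1990] Thm. A; [CastellaEtAl2021] Thm. 5.3.1; [Miller2011LMS] Def. 1.1.
-/

set_option autoImplicit false

noncomputable section

open scoped Classical MatrixGroups ModularForm

open CongruenceSubgroup WeierstrassCurve NumberField Literature.NumberTheory.EllipticCurves
  Literature.NumberTheory.EllipticCurves.ModularForms Literature.NumberTheory.QuadraticFields
  Literature.NumberTheory.EllipticCurves.Rank1Residual
  Literature.NumberTheory.EllipticCurves.Rank1Residual.Typed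
  Literature.NumberTheory.EllipticCurves.KrizLi2019
  Literature.NumberTheory.EllipticCurves.GreenbergVatsal2000
  Literature.NumberTheory.EllipticCurves.Wuthrich2014
  Literature.NumberTheory.EllipticCurves.SteinWuthrich2013

namespace Summit.BirchSwinnertonDyer.Rank1Residual.X2

/-! ### `X2.Target` implies the Heegner-index identity -/

/-- **`X2.Target` ⟹ `X2.HeegnerIndexIdentity`** (published binders: Gross–Zagier `hGZ`, Kolyvagin
`hKo`, GZK `hGZK`, modularity `hmod`): at a CellC pair with admissible data, `BSD(E,p)` is `Target`
at `E` (rank `1`), the partner `E^{d_K}` is a rank-`0` X2 pair (`classX2_twist`; `p ∣ N` splits in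
`K`) whose print shape is `Target` at a globally minimal model (`pPartRankZero_twist_of_rankZero`,
`hasGlobalMinimalModel_rat_holds`), the transport values are theorems
(`padicValNat_tamagawaProduct_twist_of_heegner_of_odd`, `padicValRat_u_eq_zero_of_smul_quadraticTwist`),
and `indexIdentityAt_of_bsdp` concludes. [cite: CastellaEtAl2021, Thm. 5.3.1] [cite: Miller2011LMS, Def. 1.1] -/
theorem heegnerIndexIdentity_of_target
    (hGZ : ∀ (N : ℕ) [NeZero N] (W : WeierstrassCurve ℚ) (K : Type) [Field K] [NumberField K],
      gross_zagier N W K)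
    (hKo : ∀ (N : ℕ) [NeZero N] (W : WeierstrassCurve ℚ) (K : Type) [Field K] [NumberField K],
      kolyvagin N W K)
    (hGZK : rank_eq_analyticRank_of_analyticRank_le_one) (hmod : hasEntireLFunction_rat)
    (hT : Target) : HeegnerIndexIdentity := by
  intro W _ _ p _ N _ K _ _ Dt H ι P hp2 hmult hred hr hN hK hodd hlt hHN hLt hP hcM _
  have hp : p.Prime := Fact.out
  have hX : ClassX2 W p := ⟨hp2, hred, hmult⟩
  have hHW : SatisfiesHeegnerHypothesis (W.conductorNorm ℤ) K := by rw [hN]; exact hHN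
  -- `p ∣ N` splits in `K`
  have hpN : p ∣ W.conductorNorm ℤ :=
    (W.dvd_conductorNorm_iff_not_hasGoodReductionAtPrime p).mpr
      (WeierstrassCurve.HasMultiplicativeReduction.not_hasGoodReduction (R := ℤ_[p]) hmult)
  have hsplit : SatisfiesHeegnerHypothesis p K := SatisfiesHeegnerHypothesis.of_dvd hpN hHW
  have hpd : ¬ (p : ℤ) ∣ NumberField.discr K := not_dvd_discr_of_split hK hp hp2 hsplit
  -- a globally minimal model of the twist
  have hD0 : (NumberField.discr K : ℚ) ≠ 0 := by exact_mod_cast NumberField.discr_ne_zero K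
  haveI hEt : (W.quadraticTwist (NumberField.discr K : ℚ)).IsElliptic :=
    W.isElliptic_quadraticTwist hD0
  obtain ⟨Cd, hCd⟩ := hasGlobalMinimalModel_rat_holds (W.quadraticTwist (NumberField.discr K : ℚ))
  haveI := hCd
  set Wd : WeierstrassCurve ℚ := Cd • W.quadraticTwist (NumberField.discr K : ℚ) with hWd_def
  have hWd : Cd • W.quadraticTwist (NumberField.discr K : ℚ) = Wd := rfl
  have hWd' : ∃ C : VariableChange ℚ, C • Wd = W.quadraticTwist (NumberField.discr K : ℚ) :=
    ⟨Cd⁻¹, by rw [← hWd, inv_smul_smul]⟩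
  -- the partner is a rank-`0` X2 pair; `Target` gives its print shape
  have hLt' : (W.quadraticTwist (NumberField.discr K : ℚ)).entireLFunction = Wd.entireLFunction := by
    rw [← hWd, entireLFunction_smul]
  have hLd1 : Wd.entireLFunction 1 ≠ 0 := by rw [← hLt']; exact hLt
  have hrd : Wd.analyticRank = 0 := (Wd.analyticRank_eq_zero_iff_holds (hmod Wd)).2 hLd1
  have h0 : ∀ (W' : WeierstrassCurve ℚ) [W'.IsElliptic] [W'.IsGloballyMinimal],
      ClassX2 W' p → W'.analyticRank = 0 → BSDp W' p :=
    fun W' _ _ hX' hr' => hT W' p (by rw [hr']; exact zero_le_one) hX'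
  have htw : PPartRankZero Wd p :=
    pPartRankZero_twist_of_rankZero hmod hGZK W p hX h0 K hK hsplit Wd hWd' hrd
  -- the transport values (gen 3 theorems)
  have htam : padicValNat p Wd.tamagawaProduct = padicValNat p W.tamagawaProduct :=
    padicValNat_tamagawaProduct_twist_of_heegner_of_odd W p hp2 K hK hodd hpd hHW Cd hWd
  have hu : padicValRat p (Cd.u : ℚ) = 0 :=
    padicValRat_u_eq_zero_of_smul_quadraticTwist W p hp2 (NumberField.discr_ne_zero K) hpd hmult
      Wd Cd hWd
  -- `BSD(E,p)` from `Target`, then the backwards descent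
  have hbsd : BSDp W p := hT W p (by rw [hr]) hX
  have hμ : ¬ p ∣ Units.torsionOrder K := not_dvd_unitsTorsionOrder_of_discr_lt hK hlt hp hp2
  exact indexIdentityAt_of_bsdp W p N K Dt H ι P (hGZ N W K) (hKo N W K) hGZK hmod hK hHN hP hp2
    hcM hμ hr hLt Wd Cd hWd htw htam hu hbsd

/-! ### The two typed inputs are jointly exact -/

/-- **`X2.Target ⟺ (Mazur's main conjecture at every X2b pair) ∧ (the Heegner-index identity over
`K` at `p ‖ N`)**, granted the PUBLISHED named facts (binders: Greenberg–Vatsal at `p ‖ N` [flag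
`GV00-mult-asserted`], Wuthrich Thm. 16, Stein–Wuthrich Thm. 6.1/§4.2, Greenberg–Stevens,
Gross–Zagier, Kolyvagin, GZK, modularity, Hoffstein–Luo, Edixhoven, Mazur 1978, Cassels). ⇐ is
`target_of_published_of_missingInputB_of_heegnerIndexIdentity''` (X2/RankOneManin); ⇒ is
`targets_of_target` + `cellB_mazurMainConjectureAt_iff_bsdp` (X2/RankZeroExact) +
`heegnerIndexIdentity_of_target`. The CONSTRUCTION-SHAPED remainder of class X2 is, in the kernel,
EXACTLY this pair of statements. [cite: Miller2011LMS, Def. 1.1 and §1] [cite: CastellaEtAl2021, Thm. 5.3.1]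
[cite: Wuthrich2014, Thm. 16 (p. 397)] -/
theorem target_iff_missingInputB_and_heegnerIndexIdentity
    (hGV : lambdaMu_multiplicative_of_gvPar) (hWu : thm16_charIdeal_dvd_multiplicative_of_reducible)
    (hJs : thm61_splitMultiplicative) (hJn : thm61_nonsplitMultiplicative)
    (hHs : exists_isSplitMultCanonical) (hHn : exists_isMultCanonical)
    (hpar : nonempty_modularParametrizationData)
    (hGS : ∀ (W : WeierstrassCurve ℚ) [W.IsElliptic] [W.IsGloballyMinimal] (p : ℕ) [Fact p.Prime],
      greenberg_stevens (W := W) (p := p))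
    (hGZ : ∀ (N : ℕ) [NeZero N] (W : WeierstrassCurve ℚ) (K : Type) [Field K] [NumberField K],
      gross_zagier N W K)
    (hKo : ∀ (N : ℕ) [NeZero N] (W : WeierstrassCurve ℚ) (K : Type) [Field K] [NumberField K],
      kolyvagin N W K)
    (hHP : ∀ (N : ℕ) [NeZero N] (W : WeierstrassCurve ℚ) (K : Type) [Field K] [NumberField K],
      heegnerPointComplex_mem_range_map N W K)
    (hGZK : rank_eq_analyticRank_of_analyticRank_le_one) (hnf : exists_isNewformOf)
    (hHL : HoffsteinLuo1997_exists_twist_L_one_ne_zero)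
    (hEd : edixhoven_optimalManinConstant_integral) (hMaz : mazur_not_dvd_maninConstant_of_odd)
    (hCassels : bsdRHS_eq_of_isIsogenous) :
    Target ↔
      (∀ (W : WeierstrassCurve ℚ) [W.IsElliptic] [W.IsGloballyMinimal] (p : ℕ) [Fact p.Prime],
        CellB W p → MissingInputB W p) ∧ HeegnerIndexIdentity := by
  have hmod' := WeierstrassCurve.hasEntireLFunction_rat_of_exists_isNewformOf hnf
  constructor
  · intro hT
    refine ⟨fun W _ _ p _ hc => ?_, heegnerIndexIdentity_of_target hGZ hKo hGZK hmod' hT⟩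
    exact (cellB_mazurMainConjectureAt_iff_bsdp hWu hJs hJn hHs hHn hGZK hmod' hpar W p (hGS W p)
      hc).mpr ((targets_of_target hT).2.1 W p hc)
  · rintro ⟨hB, hHI⟩
    exact target_of_published_of_missingInputB_of_heegnerIndexIdentity'' hGV hWu hJs hJn hHs hHn hpar
      hGS hGZ hKo hHP hGZK hnf hHL hEd hMaz hCassels hB hHI

/-! ### Appendix (gen 3): Mazur's main conjecture passes along `ℚ`-isogenies at a rank-`0` X2 pair -/

/-- **Mazur's main conjecture at an odd multiplicative Eisenstein prime, analytic rank `0`, is a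
`ℚ`-isogeny invariant** (globally minimal models `W ∼ W'`): MC at `(W,p)` ⟹ `BSD(W,p)` (gen 1) ⟹
`BSD(W',p)` (Cassels, `bsdp_of_isIsogenous_of_bsdp`) ⟹ MC at `(W',p)` (`mazurMainConjectureAt_of_bsdp_of_red`;
reducibility, multiplicative reduction and the analytic rank pass along the isogeny). Classically
this is Perrin-Riou's / Schneider's isogeny formula for `μ` (Wuthrich 2014 Lemma 17); here it
comes out of the converse chain, `μ` untouched — e.g. MC at the optimal curve (where the census finds
`μ^an = 0`) is equivalent to MC at an isogenous curve carrying a ramified-odd line (`μ ≥ 1`,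
Greenberg Prop. 5.7). [cite: Wuthrich2014, Thm. 16 and Lemma 17 (p. 397)] [cite: MilneADT2006, Thm. I.7.3]
[cite: GreenbergLNM1716, §4 (PDF pp. 112–113) and Prop. 5.7] -/
theorem mazurMainConjectureAt_of_isIsogenous
    (hWu : thm16_charIdeal_dvd_multiplicative_of_reducible)
    (hJs : thm61_splitMultiplicative) (hJn : thm61_nonsplitMultiplicative)
    (hHs : exists_isSplitMultCanonical) (hHn : exists_isMultCanonical)
    (hGZK : rank_eq_analyticRank_of_analyticRank_le_one) (hnf : exists_isNewformOf)
    (hpar : nonempty_modularParametrizationData) (hCassels : bsdRHS_eq_of_isIsogenous)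
    (hGS : ∀ (W : WeierstrassCurve ℚ) [W.IsElliptic] [W.IsGloballyMinimal] (p : ℕ) [Fact p.Prime],
      greenberg_stevens (W := W) (p := p))
    {W W' : WeierstrassCurve ℚ} [W.IsElliptic] [W'.IsElliptic] [W.IsGloballyMinimal]
    [W'.IsGloballyMinimal] (hiso : IsIsogenous W W') (p : ℕ) [Fact p.Prime] (hp2 : p ≠ 2)
    (hmult : W.HasMultiplicativeReductionAtPrime p) (hred : ¬ W.HasIrreducibleModPGaloisRep p)
    (hr : W.analyticRank = 0) (hMC : MazurMainConjectureAt W p) : MazurMainConjectureAt W' p := by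
  have hp : p.Prime := Fact.out
  have hmod' := WeierstrassCurve.hasEntireLFunction_rat_of_exists_isNewformOf hnf
  -- the data pass along the isogeny
  have hr' : W'.analyticRank = 0 := by rw [← analyticRank_eq_of_isIsogenous' hiso]; exact hr
  have hred' : ¬ W'.HasIrreducibleModPGaloisRep p := not_hasIrreducibleModPGaloisRep_of_isIsogenous hiso hred
  have hmult' : W'.HasMultiplicativeReductionAtPrime p := by
    have hb := WeierstrassCurve.hasMultiplicativeReductionAtPrime_iff_hasMultiplicativeReductionAt_holds
    have h1 : W.HasMultiplicativeReductionAt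
        ((Rat.HeightOneSpectrum.primesEquiv (R := ℤ)).symm ⟨p, hp⟩) := (hb W ⟨p, hp⟩).mp hmult
    exact (hb W' ⟨p, hp⟩).mpr (hasMultiplicativeReductionAt_of_isIsogenous hiso _ h1)
  -- MC(W) ⟹ BSD(W,p) ⟹ BSD(W',p) ⟹ MC(W')
  have hbsd : BSDp W p :=
    bsdp_of_mazurMainConjectureAt_of_analyticRank_eq_zero hJs hJn hHs hHn hGZK hmod' hpar W p (hGS W p)
      hp2 hmult hr hMC
  have hbsd' : BSDp W' p :=
    bsdp_of_isIsogenous_of_bsdp hCassels hGZK hmod' W W' hiso p (by rw [hr]; exact zero_le_one) hbsd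
  exact mazurMainConjectureAt_of_bsdp_of_red hWu hJs hJn hHs hHn hGZK hmod' W' p (hGS W' p) hp2 hmult'
    hred' hr' hbsd'

end Summit.BirchSwinnertonDyer.Rank1Residual.X2

end
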